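import Summits.SmoothPoincare4.SmoothPoincare4.Theorems.EntropyRungCompactShrinkerGapHotRegionVolume
import Summits.SmoothPoincare4.SmoothPoincare4.Theorems.EntropyRungCompactShrinkerGapScalarIdentities
import Summits.SmoothPoincare4.SmoothPoincare4.Theorems.EntropyRungCompactShrinkerGapScalarCurvaturePos
import Literature.Geometry.Riemannian.WeightedHeatFlowCompleteDecay
import Literature.AlgebraicTopology.FundamentalGroup.SphereSimplyConnected
import Mathlib.Analysis.SpecialFunctions.Sqrt
import HarnessLib

/-!
# Hot balls of a dense closed shrinker are small: the gradient climb
(line `cgy-variance-pivot`, door A‴ / STUB 25′ `stub_scalarLeTen_of_volume`, crux `EntropyRung.CompactShrinkerGap`,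
item stmt-SmoothPoincare4-10870; registered helpers `helper_hotBallSubset`, `helper_hotBallVolume`)

For a normalised gradient shrinker `Ric + Hess f = g/2`, `R + |∇f|² = f` on a closed 4-manifold one has `R > 0`
(landed, `stub_scalarCurvaturePos_of_identities`), hence `f > 0` and `|∇√f|² = |∇f|²/(4f) = (f − R)/(4f) < ¼`:
`√f` is `½`-Lipschitz for the Riemannian distance (`abs_sub_le_mul_toReal_edist`). Consequently the geodesic
ball of radius `2(√f(p) − 2)` about ANY point `p` lies in the superlevel set `{f > 4}` — the "climb" of the thin
finger (skeleton v15.1, STUB 25′ docstring): the hot region must contain a ball whose radius grows like `2√F`.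
With the landed hot-region bound (`helper_hotRegionVolume`: `(1 − 3e^{-2})·Vol{f ≥ 4} ≤ 96π² − 32π²√π e^{1/2}`
under `Vol ≤ 96π²`) this gives the kernel-checked core of the finger picture:

* `helper_hotBallSubset` — crux data: `d_g(p, y) < 2(√(f p) − 2) ⟹ 4 < f y`;
* `helper_hotBallVolume` — crux data and `Vol(M,g) ≤ 96π²`:
  `(1 − 3e^{-2}) · Vol{y : d_g(p,y) < 2(√(f p) − 2)} ≤ 96π² − 32π²√π e^{1/2}` (`≈ 24.6`) for every `p`.

So a violator of `R ≤ 10` (`f(p) = F > 10` at its maximum point) carries a geodesic ball of radius `> 2.32` and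
volume `< 41.5` — Euclidean balls of that radius have volume `143`. No Theses statement is concluded.

References: H.-D. Cao, D. Zhou, J. Differential Geom. 85 (2010), (2.3) (`|∇f|² ≤ f`, `√f` is ½-Lipschitz);
H.-D. Cao, R. S. Hamilton, T. Ilmanen, arXiv:math/0404165, §4.
-/

noncomputable section

-- the registered namespace `Summit.SmoothPoincare4.SmoothPoincare4.Theorems` repeats a component (summit = sub-problem)
set_option linter.dupNamespace false

open MeasureTheory Set
open scoped Manifold ContDiff ENNReal Topology ContinuousMap

namespace Summit.SmoothPoincare4.SmoothPoincare4.Theorems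

open Literature.Geometry Literature.Geometry.Lorentzian Literature.Geometry.Riemannian
  Literature.Geometry.Lorentzian.PseudoRiemannianMetric

/-- **The climb (registered helper `helper_hotBallSubset`).** For the crux data (closed `M ≃ₕ S⁴`, normalised
gradient shrinker): if `d_g(p, y) < 2(√(f p) − 2)` then `f y > 4`. Proof: `R > 0` on the closed shrinker, so
`f = R + |∇f|² > 0` and `|∇√f|² = |∇f|²/(4f) = (f − R)/(4f) ≤ ¼`; on the connected `M` a gradient bound is a
Lipschitz bound, `|√f(p) − √f(y)| ≤ ½ d_g(p,y) < √(f p) − 2`, whence `√(f y) > 2`. [cite: CaoZhou2010, (2.3)] -/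
theorem helper_hotBallSubset :
    ∀ (M : Type) [TopologicalSpace M] [T2Space M] [SecondCountableTopology M]
      [ChartedSpace (EuclideanSpace ℝ (Fin 4)) M] [IsManifold (𝓡 4) ∞ M] [CompactSpace M]
      [T3Space M] [MeasurableSpace M] [BorelSpace M],
      M ≃ₕ Metric.sphere (0 : EuclideanSpace ℝ (Fin 5)) 1 →
    ∀ (g : Literature.Geometry.Lorentzian.PseudoRiemannianMetric (𝓡 4) ∞ (EuclideanSpace ℝ (Fin 4))
        (TangentSpace (𝓡 4) : M → Type _)) [g.HasLeviCivita] (f : M → ℝ) (hg : g.IsRiemannian),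
      ContMDiff (𝓡 4) 𝓘(ℝ, ℝ) ∞ f →
      (∀ (x : M) (X Y : TangentSpace (𝓡 4) x),
        g.ricci x X Y + g.hessian f x X Y = (1 / 2 : ℝ) * g.val x X Y) →
      (∀ x : M, g.scalarCurvature x + g.gradSq f x = f x) →
      ∀ p y : M, (g.edist hg p y).toReal < 2 * (Real.sqrt (f p) - 2) → 4 < f y := by
  intro M _ _ _ _ _ _ _ _ _ e g _ f hg hf hsol hnorm p y hpy
  -- `M ≃ₕ S⁴` is simply connected, hence connected
  haveI : SimplyConnectedSpace (Metric.sphere (0 : EuclideanSpace ℝ (Fin (4 + 1))) 1) :=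
    Literature.AlgebraicTopology.FundamentalGroup.simplyConnectedSpace_euclideanSphere 4 (by norm_num)
  haveI : SimplyConnectedSpace M := e.simplyConnectedSpace_iff.2 inferInstance
  -- `R > 0`, hence `f > 0` and `|∇f|² < f`
  obtain ⟨_, hB⟩ := stub_shrinkerScalarIdentities M g f hg hf hsol
  have hR : ∀ x : M, 0 < g.scalarCurvature x := stub_scalarCurvaturePos_of_identities M g f hg hf hsol hB
  have hf0 : ∀ x, 0 < f x := fun x ↦ by
    have h := hnorm x
    linarith [hR x, g.gradSq_nonneg hg f x]
  have hgradf : ∀ x, g.gradSq f x < f x := fun x ↦ by linarith [hnorm x, hR x]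
  -- `u = √f` is `C¹` with `|∇u|² ≤ ¼`
  set u : M → ℝ := fun x ↦ Real.sqrt (f x) with hu
  have hu1 : ContMDiff (𝓡 4) 𝓘(ℝ, ℝ) 1 u := fun x ↦
    (Real.contDiffAt_sqrt (hf0 x).ne').comp_contMDiffAt ((hf x).of_le (by norm_num))
  have hgrad : ∀ x, g.gradSq u x ≤ (1 / 2 : ℝ) ^ 2 := fun x ↦ by
    have hfx : MDifferentiableAt (𝓡 4) 𝓘(ℝ, ℝ) f x := hf.mdifferentiableAt (by simp)
    have key := g.gradSq_real_comp (h := Real.sqrt) (Real.hasDerivAt_sqrt (hf0 x).ne') hfx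
    rw [show u = Real.sqrt ∘ f from rfl, key]
    have hfx0 : 0 < f x := hf0 x
    have hs : 0 < Real.sqrt (f x) := Real.sqrt_pos.2 hfx0
    have hsq : Real.sqrt (f x) ^ 2 = f x := Real.sq_sqrt hfx0.le
    have h1 : (1 / (2 * Real.sqrt (f x))) ^ 2 = 1 / (4 * f x) := by
      rw [div_pow, one_pow, mul_pow, hsq]
      norm_num
    rw [h1, div_mul_eq_mul_div, one_mul, div_le_iff₀ (by positivity : (0 : ℝ) < 4 * f x)]
    nlinarith [hgradf x, g.gradSq_nonneg hg f x]
  -- Lipschitz: `|√f p − √f y| ≤ ½ d(p,y)`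
  have hlip := abs_sub_le_mul_toReal_edist hg hu1 (by norm_num : (0 : ℝ) ≤ 1 / 2) hgrad p y
  have h1 : Real.sqrt (f p) - Real.sqrt (f y) < Real.sqrt (f p) - 2 := by
    calc Real.sqrt (f p) - Real.sqrt (f y) ≤ |u p - u y| := le_abs_self _
      _ ≤ 1 / 2 * (g.edist hg p y).toReal := hlip
      _ < Real.sqrt (f p) - 2 := by linarith
  have h2 : 2 < Real.sqrt (f y) := by linarith
  have h3 : (2 : ℝ) ^ 2 < Real.sqrt (f y) ^ 2 := by
    exact pow_lt_pow_left₀ h2 (by norm_num) (by norm_num)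
  rw [Real.sq_sqrt (hf0 y).le] at h3
  linarith

/-- **Hot balls are small (registered helper `helper_hotBallVolume`).** For the crux data with, in addition,
`Vol(M,g) ≤ 96π²`: for every point `p`,
`(1 − 3e^{-2}) · Vol{y : d_g(p,y) < 2(√(f p) − 2)} ≤ 96π² − 32π²√π e^{1/2}` (`≈ 2.49π² ≈ 24.6`). Proof: the ball
lies in `{f ≥ 4}` (`helper_hotBallSubset`) and `(1 − 3e^{-2})·Vol{f ≥ 4} ≤ 96π² − 32π²√π e^{1/2}`
(`helper_hotRegionVolume` at `T = 4`). At the maximum point of `f` (`f(p) = F = max R`) the radius is `2(√F − 2)`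
(`2.32` at `F = 10`), against the Euclidean volume `(π²/2)·2.32⁴ ≈ 143` of such a ball.
[cite: CaoZhou2010, (2.3)] [cite: CaoHamiltonIlmanen2004, §4] -/
theorem helper_hotBallVolume :
    ∀ (M : Type) [TopologicalSpace M] [T2Space M] [SecondCountableTopology M]
      [ChartedSpace (EuclideanSpace ℝ (Fin 4)) M] [IsManifold (𝓡 4) ∞ M] [CompactSpace M]
      [T3Space M] [MeasurableSpace M] [BorelSpace M],
      M ≃ₕ Metric.sphere (0 : EuclideanSpace ℝ (Fin 5)) 1 →
    ∀ (g : Literature.Geometry.Lorentzian.PseudoRiemannianMetric (𝓡 4) ∞ (EuclideanSpace ℝ (Fin 4))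
        (TangentSpace (𝓡 4) : M → Type _)) [g.HasLeviCivita] (f : M → ℝ) (hg : g.IsRiemannian),
      ContMDiff (𝓡 4) 𝓘(ℝ, ℝ) ∞ f →
      (∀ (x : M) (X Y : TangentSpace (𝓡 4) x),
        g.ricci x X Y + g.hessian f x X Y = (1 / 2 : ℝ) * g.val x X Y) →
      (∀ x : M, g.scalarCurvature x + g.gradSq f x = f x) →
      ENNReal.ofReal (32 * Real.pi ^ 2 * Real.sqrt Real.pi * Real.exp (-(3 : ℝ) / 2)) <
        ∫⁻ x, ENNReal.ofReal (Real.exp (-f x))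
          ∂(Literature.Geometry.Lorentzian.riemannianMeasure (g.toContMDiffRiemannianMetric hg)) →
      ((Literature.Geometry.Lorentzian.riemannianMeasure (g.toContMDiffRiemannianMetric hg)) Set.univ).toReal ≤
        96 * Real.pi ^ 2 →
      ∀ p : M,
        (1 - 3 * Real.exp (-2)) *
            ((Literature.Geometry.Lorentzian.riemannianMeasure (g.toContMDiffRiemannianMetric hg))
              {y | (g.edist hg p y).toReal < 2 * (Real.sqrt (f p) - 2)}).toReal ≤
          96 * Real.pi ^ 2 - 32 * Real.pi ^ 2 * Real.sqrt Real.pi * Real.exp (1 / 2) := by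
  intro M _ _ _ _ _ _ _ _ _ e g _ f hg hf hsol hnorm hdens hvol p
  set μ := riemannianMeasure (g.toContMDiffRiemannianMetric hg) with hμ
  haveI : IsFiniteMeasure μ :=
    ⟨riemannianVolume_lt_top_of_isCompact_holds (g.toContMDiffRiemannianMetric hg) le_rfl isCompact_univ⟩
  -- the ball sits in the hot region `{f ≥ 4}`
  have hsub : {y | (g.edist hg p y).toReal < 2 * (Real.sqrt (f p) - 2)} ⊆ {y | 4 ≤ f y} :=
    fun y hy ↦ (helper_hotBallSubset M e g f hg hf hsol hnorm p y hy).le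
  have hmono : (μ {y | (g.edist hg p y).toReal < 2 * (Real.sqrt (f p) - 2)}).toReal ≤
      (μ {y | 4 ≤ f y}).toReal :=
    ENNReal.toReal_mono (measure_lt_top μ _).ne (measure_mono hsub)
  -- the hot-region bound at `T = 4`
  have hhot := helper_hotRegionVolume M g f hg hf hsol hnorm hdens hvol 4 (by norm_num)
  rw [show (4 : ℝ) - 1 = 3 by norm_num, show (2 : ℝ) - 4 = -2 by norm_num] at hhot
  -- `1 − 3e^{-2} ≥ 0` (`e² > 3`)
  have hcoef : 0 ≤ 1 - 3 * Real.exp (-2) := by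
    have h9 : Real.exp 1 > 2.7182818283 := Real.exp_one_gt_d9
    have he2 : 3 < Real.exp 2 := by
      have : Real.exp 2 = Real.exp 1 * Real.exp 1 := by rw [← Real.exp_add]; norm_num
      rw [this]; nlinarith
    have hinv : Real.exp (-2) = (Real.exp 2)⁻¹ := Real.exp_neg 2
    rw [hinv, sub_nonneg, ← div_eq_mul_inv, div_le_one (Real.exp_pos 2)]
    exact he2.le
  calc (1 - 3 * Real.exp (-2)) * (μ {y | (g.edist hg p y).toReal < 2 * (Real.sqrt (f p) - 2)}).toReal
      ≤ (1 - 3 * Real.exp (-2)) * (μ {y | 4 ≤ f y}).toReal := mul_le_mul_of_nonneg_left hmono hcoef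
    _ ≤ 96 * Real.pi ^ 2 - 32 * Real.pi ^ 2 * Real.sqrt Real.pi * Real.exp (1 / 2) := hhot

end Summit.SmoothPoincare4.SmoothPoincare4.Theorems

end
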